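import Literature.AlgebraicTopology.SingularHomology.UniverseTransportIso
import Literature.AlgebraicTopology.SingularHomology.RelativeCapProduct
import HarnessLib

/-!
# Singular cohomology and the relative cap product along homeomorphisms across universes

A. Hatcher, *Algebraic Topology* (2002), §3.1 (induced homomorphisms `f^♯φ = φ ∘ f♯` on cochains,
"the dual of `f♯`") and §3.3 p. 241 (naturality of the cap product, `f⁎(f^*φ ⌢ α) = φ ⌢ f⁎α`,
"the relative versions also hold"). For a homeomorphism `e : X ≃ₜ Y` between spaces in possibly
DIFFERENT universes the tree's functorial maps `f♯`, `f^♯` are not available (they are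
`TopCat.{u}`-functors); `…UniverseTransportIso` supplies the chain-level substitute `e♯`
(`SingularSimplex.pushEquiv`, `csingularChainComplex.xEquiv`, `relativeSingularHomology.xEquiv`).
This file adds the cohomological side and the cap product:

* `singularCochainComplex.xEquiv e` — the cross-universe isomorphism of singular cochain
  complexes `C•(Y; M) ≅ C•(X; M)`, `φ ↦ φ ∘ e♯` (a cochain map since `e♯` commutes with faces);
  `singularCohomology.xEquiv e p : Hᵖ(Y; M) ≃ₗ[R] Hᵖ(X; M)` and its value on classes of cocycles;
* `SingularSimplex.push_frontFace`, `push_backFace`, `ccapChain_push` — `e♯(x ⌢ e^♯φ) = e♯x ⌢ φ`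
  on concrete chains (Hatcher p. 241 at chain level);
* `relativeSingularHomology.xEquiv_relCapProduct` — **`e⁎(e^*b ⌢ z) = b ⌢ e⁎z`** for the relative
  cap product `relCapProduct` (`…RelativeCapProduct`) along a homeomorphism of pairs
  `e : (X, A) → (Y, B)` across universes;
* `relativeSingularHomology.bijective_relCapProduct_iff_of_homeomorph` — bijectivity of
  `a ↦ a ⌢ z` is invariant.

Client: the universe-polymorphic discharge of Lefschetz duality (`…LefschetzDualityProofs`), whose
engine (Miller's Thm. 37.1, `…CechDualityCompactSets`) lives in `Type`. Everything is proved; no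
named facts.

## References

* A. Hatcher, *Algebraic Topology*, CUP 2002, §3.1 p. 197–201, §3.3 pp. 239–241. [HatcherAT2002]
-/

noncomputable section

-- as in `SingularChainsConcrete` / `UniverseTransportIso`: chains of the concrete complex are
-- `Finsupp`s up to unfolding of semireducible definitions
set_option backward.isDefEq.respectTransparency false

open CategoryTheory Limits Set

universe u u' v

namespace Literature.AlgebraicTopology.SingularHomology

variable (R : Type v) [CommRing R] (M : Type v) [AddCommGroup M] [Module R M]
variable {X : Type u} {Y : Type u'} [TopologicalSpace X] [TopologicalSpace Y]

/-! ### Front and back faces commute with push-forward -/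

namespace SingularSimplex

variable {p q n : ℕ}

omit R M in
/-- `toContinuousMap` of a front face is the restriction along the front inclusion of standard
simplices. [folklore] -/
lemma toContinuousMap_frontFace (h : p ≤ n) (σ : SingularSimplex X n) :
    toContinuousMap (σ.frontFace h) =
      (toContinuousMap σ).comp ⟨stdSimplex.map ⇑(SimplexCategory.subinterval 0 p (by omega)).toOrderHom,
        stdSimplex.continuous_map _⟩ :=
  rfl

omit R M in
/-- `toContinuousMap` of a back face is the restriction along the back inclusion of standard
simplices. [folklore] -/
lemma toContinuousMap_backFace (h : q ≤ n) (σ : SingularSimplex X n) :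
    toContinuousMap (σ.backFace h) =
      (toContinuousMap σ).comp ⟨stdSimplex.map ⇑(SimplexCategory.subinterval (n - q) q (by omega)).toOrderHom,
        stdSimplex.continuous_map _⟩ :=
  rfl

omit R M in
/-- **Front faces commute with push-forward across universes** (Hatcher 2002, §3.2, naturality).
[cite: HatcherAT2002, §3.2 proof of Prop. 3.10] -/
theorem push_frontFace (f : C(X, Y)) (h : p ≤ n) (σ : SingularSimplex X n) :
    (σ.push f).frontFace h = (σ.frontFace h).push f := by
  apply toContinuousMap_injective
  rw [toContinuousMap_frontFace, toContinuousMap_push, toContinuousMap_push, toContinuousMap_frontFace,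
    ContinuousMap.comp_assoc]

omit R M in
/-- **Back faces commute with push-forward across universes** (Hatcher 2002, §3.2, naturality).
[cite: HatcherAT2002, §3.2 proof of Prop. 3.10] -/
theorem push_backFace (f : C(X, Y)) (h : q ≤ n) (σ : SingularSimplex X n) :
    (σ.push f).backFace h = (σ.backFace h).push f := by
  apply toContinuousMap_injective
  rw [toContinuousMap_backFace, toContinuousMap_push, toContinuousMap_push, toContinuousMap_backFace,
    ContinuousMap.comp_assoc]

end SingularSimplex

/-! ### The cap product on concrete chains commutes with push-forward -/

section CCap

variable {R M} {p q n : ℕ}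

/-- **`e♯(x ⌢ (φ ∘ e♯)) = e♯ x ⌢ φ` on concrete chains** for a continuous `f` across universes
(Hatcher 2002, §3.3 p. 241, the chain-level projection formula `f♯(c) ⌢ φ = f♯(c ⌢ f^♯φ)`).
[cite: HatcherAT2002, §3.3 p. 241] -/
theorem ccapChain_push (f : C(X, Y)) (h : p + q = n) (φ : SingularSimplex Y p → R)
    (x : (csingularChainComplex R M X).X n) :
    CChain.push R M f q (ccapChain M h (fun σ => φ (σ.push f)) x) =
      ccapChain M h φ (CChain.push R M f n x) := by
  refine Finsupp.induction_linear x (by simp) (fun a b ha hb => ?_) fun σ m => ?_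
  · rw [map_add, map_add, ha, hb, map_add, map_add]
  · change CChain.push R M f q (ccapChain M h _ (Finsupp.single σ m)) =
      ccapChain M h φ (CChain.push R M f n (Finsupp.single σ m))
    rw [ccapChain_single, CChain.push_single, CChain.push_single, ccapChain_single,
      SingularSimplex.push_frontFace, SingularSimplex.push_backFace]

end CCap

/-! ### Singular cochains and cohomology along a homeomorphism across universes -/

namespace singularCochainComplex

/-- **The singular cochain complexes of homeomorphic spaces in different universes are
isomorphic**: `C•(Y; M) ≅ C•(X; M)`, `φ ↦ φ ∘ e♯` degreewise (Hatcher 2002, §3.1, `f^♯φ = φ f♯`),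
a cochain map because `e♯` commutes with the faces. [cite: HatcherAT2002, §3.1 p. 197] -/
def xEquiv (e : X ≃ₜ Y) : ComplexXEquiv (singularCochainComplex R M Y) (singularCochainComplex R M X) where
  e k := LinearEquiv.funCongrLeft R M (SingularSimplex.pushEquiv k e)
  comm i j φ := by
    by_cases hij : (ComplexShape.up ℕ).Rel i j
    · obtain rfl : i + 1 = j := hij
      funext τ
      change (singularCochainComplex R M Y).d i (i + 1) φ (SingularSimplex.pushEquiv (i + 1) e τ) =
        (singularCochainComplex R M X).d i (i + 1) (fun σ => φ (SingularSimplex.pushEquiv i e σ)) τ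
      rw [d_apply, d_apply]
      refine Finset.sum_congr rfl fun k _ => ?_
      rw [SingularSimplex.pushEquiv_apply, SingularSimplex.pushEquiv_apply, SingularSimplex.push_face]
    · rw [(singularCochainComplex R M Y).shape _ _ hij, (singularCochainComplex R M X).shape _ _ hij]
      simp

/-- The degreewise equivalence is precomposition with `e♯`. [folklore] -/
lemma xEquiv_e_apply (e : X ≃ₜ Y) (k : ℕ) (φ : (singularCochainComplex R M Y).X k) (σ : SingularSimplex X k) :
    (xEquiv R M e).e k φ σ = φ (σ.push (e : C(X, Y))) := rfl

end singularCochainComplex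

namespace singularCohomology

/-- **Singular cohomology along a homeomorphism across universes**: `Hᵖ(Y; M) ≃ₗ[R] Hᵖ(X; M)`
for `e : X ≃ₜ Y` (Hatcher 2002, §3.1, a homeomorphism induces isomorphisms). [cite: HatcherAT2002, §3.1 p. 201] -/
def xEquiv (e : X ≃ₜ Y) (p : ℕ) : singularCohomology R M Y p ≃ₗ[R] singularCohomology R M X p :=
  (singularCochainComplex.xEquiv R M e).homologyEquiv p

/-- **On classes of cocycles**: `xEquiv e [a] = [a']` whenever `a' = a ∘ e♯` as cochains. [folklore] -/
theorem xEquiv_π (e : X ≃ₜ Y) (p : ℕ) (a : singularCochainComplex.cocycles R M Y p)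
    (a' : singularCochainComplex.cocycles R M X p)
    (h : singularCochainComplex.iCocycles R M X p a' =
      (singularCochainComplex.xEquiv R M e).e p (singularCochainComplex.iCocycles R M Y p a)) :
    xEquiv R M e p (singularCohomology.π R M Y p a) = singularCohomology.π R M X p a' := by
  have ha : (singularCochainComplex R M Y).d p ((ComplexShape.up ℕ).next p)
      (singularCochainComplex.iCocycles R M Y p a) = 0 := by
    rw [← ModuleCat.comp_apply, HomologicalComplex.iCycles_d]; rfl
  have ha' : (singularCochainComplex R M X).d p ((ComplexShape.up ℕ).next p)
      (singularCochainComplex.iCocycles R M X p a') = 0 := by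
    rw [← ModuleCat.comp_apply, HomologicalComplex.iCycles_d]; rfl
  have e1 : singularCohomology.π R M Y p a = homologyCls (singularCochainComplex.iCocycles R M Y p a) ha := by
    rw [homologyCls_eq_homologyπ_cyclesMk _ ha ((ComplexShape.up ℕ).next p) rfl ha]
    congr 1
    apply (ModuleCat.mono_iff_injective (singularCochainComplex.iCocycles R M Y p)).mp inferInstance
    exact ((singularCochainComplex R M Y).i_cyclesMk _ _ _ _).symm
  have e2 : singularCohomology.π R M X p a' = homologyCls (singularCochainComplex.iCocycles R M X p a') ha' := by
    rw [homologyCls_eq_homologyπ_cyclesMk _ ha' ((ComplexShape.up ℕ).next p) rfl ha']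
    congr 1
    apply (ModuleCat.mono_iff_injective (singularCochainComplex.iCocycles R M X p)).mp inferInstance
    exact ((singularCochainComplex R M X).i_cyclesMk _ _ _ _).symm
  rw [e1, e2]
  show (singularCochainComplex.xEquiv R M e).homologyEquiv p
      (homologyCls (singularCochainComplex.iCocycles R M Y p a) ha) = _
  rw [(singularCochainComplex.xEquiv R M e).homologyEquiv_homologyCls _ ha
    ((singularCochainComplex.xEquiv R M e).d_e_eq_zero ha)]
  exact homologyCls_congr h.symm _ _

/-- Every class of `Hᵖ(X)` is `xEquiv e` of a class: for a cocycle `a'` of `X`, the cochain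
`a' ∘ (e⁻¹)♯` is a cocycle of `Y` mapping to `[a']`. [folklore] -/
theorem xEquiv_surjective_π (e : X ≃ₜ Y) (p : ℕ) (a' : singularCochainComplex.cocycles R M X p) :
    ∃ a : singularCochainComplex.cocycles R M Y p,
      singularCochainComplex.iCocycles R M X p a' =
        (singularCochainComplex.xEquiv R M e).e p (singularCochainComplex.iCocycles R M Y p a) := by
  have ha' : (singularCochainComplex R M X).d p (p + 1) (singularCochainComplex.iCocycles R M X p a') = 0 := by
    rw [← ModuleCat.comp_apply, HomologicalComplex.iCycles_d]
    rfl
  set ψ : (singularCochainComplex R M Y).X p :=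
    (singularCochainComplex.xEquiv R M e).symm.e p (singularCochainComplex.iCocycles R M X p a') with hψ
  have hψd : (singularCochainComplex R M Y).d p (p + 1) ψ = 0 := by
    rw [hψ, ← (singularCochainComplex.xEquiv R M e).symm.comm, ha', map_zero]
  refine ⟨singularCochainComplex.cocyclesMk ψ hψd, ?_⟩
  rw [singularCochainComplex.iCocycles_mk, hψ]
  exact ((singularCochainComplex.xEquiv R M e).e p).apply_symm_apply _ |>.symm

end singularCohomology

/-! ### The relative cap product along a homeomorphism of pairs across universes -/

namespace relativeSingularHomology

variable {R M} {p q n : ℕ}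

/-- `xEquiv` on a relative class given by a relative cycle of the concrete model: `[x] ↦ [e♯ x]`. [folklore] -/
lemma xEquiv_concreteIso_inv_relCls (e : X ≃ₜ Y) {A : Set X} {B : Set Y} (hAB : MapsTo e A B)
    (hBA : MapsTo e.symm B A) (k : ℕ) (x : (csingularChainComplex R M X).X k)
    (hx : (csingularChainComplex R M X).d k ((ComplexShape.down ℕ).next k) x ∈
      chainsInSub R M X A ((ComplexShape.down ℕ).next k))
    (hx' : (csingularChainComplex R M Y).d k ((ComplexShape.down ℕ).next k) (CChain.push R M (e : C(X, Y)) k x) ∈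
      chainsInSub R M Y B ((ComplexShape.down ℕ).next k)) :
    xEquiv R M e hAB hBA k ((concreteIso R M X A k).inv ((chainsInSub R M X A).relCls x hx)) =
      (concreteIso R M Y B k).inv ((chainsInSub R M Y B).relCls (CChain.push R M (e : C(X, Y)) k x) hx') := by
  simp only [xEquiv, LinearEquiv.trans_apply, Iso.toLinearEquiv_apply, Iso.symm_hom]
  rw [Iso.inv_hom_id_apply]
  congr 1
  rw [Subcomplex.relCls, (relativeConcrete.xEquiv R M e hAB hBA).homologyEquiv_homologyCls _ _
    ((relativeConcrete.xEquiv R M e hAB hBA).d_e_eq_zero ((chainsInSub R M X A).d_π_f_eq_zero x hx))]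
  exact homologyCls_congr (relativeConcrete.xEquiv_e_π R M e hAB hBA k x) _ _

/-- Push-forward of a relative cycle is a relative cycle. [folklore] -/
lemma d_push_mem (e : X ≃ₜ Y) {A : Set X} {B : Set Y} (hAB : MapsTo e A B) (k : ℕ)
    (x : (csingularChainComplex R M X).X k)
    (hx : (csingularChainComplex R M X).d k ((ComplexShape.down ℕ).next k) x ∈
      chainsInSub R M X A ((ComplexShape.down ℕ).next k)) :
    (csingularChainComplex R M Y).d k ((ComplexShape.down ℕ).next k) (CChain.push R M (e : C(X, Y)) k x) ∈
      chainsInSub R M Y B ((ComplexShape.down ℕ).next k) := by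
  have hc := (csingularChainComplex.xEquiv R M e).comm k ((ComplexShape.down ℕ).next k) x
  rw [csingularChainComplex.xEquiv_e_apply, csingularChainComplex.xEquiv_e_apply] at hc
  rw [← hc]
  exact CChain.push_mem_chainsIn R M (e : C(X, Y)) hAB hx

/-- **The relative cap product along a homeomorphism of pairs across universes**
(`e⁎(e^*b ⌢ z) = b ⌢ e⁎z`): for `e : X ≃ₜ Y` with `e(A) = B`, `b ∈ Hᵖ(Y; R)`, `z ∈ Hₙ(X, A; M)`,
`xEquiv e (xEquiv e b ⌢ z) = b ⌢ xEquiv e z` (Hatcher 2002, §3.3 p. 241, naturality of the relative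
cap product). [cite: HatcherAT2002, §3.3 p. 241] -/
theorem xEquiv_relCapProduct (e : X ≃ₜ Y) {A : Set X} {B : Set Y} (hAB : MapsTo e A B)
    (hBA : MapsTo e.symm B A) (h : p + q = n) (b : singularCohomology R R Y p)
    (z : relativeSingularHomology R M X A n) :
    xEquiv R M e hAB hBA q (relCapProduct A h (singularCohomology.xEquiv R R e p b) z) =
      relCapProduct B h b (xEquiv R M e hAB hBA n z) := by
  induction b using singularCohomology_induction_on with
  | h a =>
  obtain ⟨x, hx, rfl⟩ : ∃ (x : (csingularChainComplex R M X).X n)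
      (hx : (csingularChainComplex R M X).d n ((ComplexShape.down ℕ).next n) x ∈
        chainsInSub R M X A ((ComplexShape.down ℕ).next n)),
      (concreteIso R M X A n).inv ((chainsInSub R M X A).relCls x hx) = z := by
    obtain ⟨x, hx, e'⟩ := (chainsInSub R M X A).relCls_surjective ((concreteIso R M X A n).hom z)
    exact ⟨x, hx, by rw [e', Iso.hom_inv_id_apply]⟩
  -- a cocycle of `X` with underlying cochain `a ∘ e♯`
  set a' : singularCochainComplex.cocycles R R X p := singularCochainComplex.cocyclesMk
    ((singularCochainComplex.xEquiv R R e).e p (singularCochainComplex.iCocycles R R Y p a)) (by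
      rw [← (singularCochainComplex.xEquiv R R e).comm]
      have h0 : (singularCochainComplex R R Y).d p (p + 1) (singularCochainComplex.iCocycles R R Y p a) = 0 := by
        rw [← ModuleCat.comp_apply, HomologicalComplex.iCycles_d]
        rfl
      rw [h0, map_zero]) with ha'
  have hia' : singularCochainComplex.iCocycles R R X p a' =
      (singularCochainComplex.xEquiv R R e).e p (singularCochainComplex.iCocycles R R Y p a) :=
    singularCochainComplex.iCocycles_mk _ _
  rw [singularCohomology.xEquiv_π R R e p a a' hia', relCapProduct_π_concreteIso_inv_relCls,
    xEquiv_concreteIso_inv_relCls e hAB hBA n x hx (d_push_mem e hAB n x hx),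
    relCapProduct_π_concreteIso_inv_relCls,
    xEquiv_concreteIso_inv_relCls e hAB hBA q _ _ (d_push_mem e hAB q _ (d_ccapChain_mem_chainsInSub A h a' x hx))]
  congr 1
  refine (chainsInSub R M Y B).relCls_congr ?_ _ _
  rw [hia']
  exact ccapChain_push (e : C(X, Y)) h (singularCochainComplex.iCocycles R R Y p a) x

/-- **Bijectivity of `a ↦ a ⌢ z` is invariant under homeomorphisms of pairs across universes.**
[cite: HatcherAT2002, §3.3 p. 241] -/
theorem bijective_relCapProduct_iff_of_homeomorph (e : X ≃ₜ Y) {A : Set X} {B : Set Y}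
    (hAB : MapsTo e A B) (hBA : MapsTo e.symm B A) (h : p + q = n) (z : relativeSingularHomology R M X A n) :
    (Function.Bijective fun a : singularCohomology R R X p => relCapProduct (M := M) A h a z) ↔
      Function.Bijective fun b : singularCohomology R R Y p =>
        relCapProduct (M := M) B h b (xEquiv R M e hAB hBA n z) := by
  have key : (fun b : singularCohomology R R Y p => relCapProduct (M := M) B h b (xEquiv R M e hAB hBA n z)) =
      (xEquiv R M e hAB hBA q) ∘ (fun a : singularCohomology R R X p => relCapProduct (M := M) A h a z) ∘
        (singularCohomology.xEquiv R R e p) := by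
    funext b
    exact (xEquiv_relCapProduct e hAB hBA h b z).symm
  rw [key]
  constructor
  · intro hb
    exact ((xEquiv R M e hAB hBA q).bijective.comp hb).comp (singularCohomology.xEquiv R R e p).bijective
  · intro hb
    have h1 := (xEquiv R M e hAB hBA q).symm.bijective.comp
      (hb.comp (singularCohomology.xEquiv R R e p).symm.bijective)
    have e2 : ((xEquiv R M e hAB hBA q).symm ∘ ((xEquiv R M e hAB hBA q) ∘
        (fun a : singularCohomology R R X p => relCapProduct (M := M) A h a z) ∘
          (singularCohomology.xEquiv R R e p)) ∘ (singularCohomology.xEquiv R R e p).symm) =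
        fun a : singularCohomology R R X p => relCapProduct (M := M) A h a z := by
      funext a
      simp
    rwa [e2] at h1

end relativeSingularHomology

end Literature.AlgebraicTopology.SingularHomology

end
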